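import Summits.RiemannHypothesis.RiemannHypothesis.Theses.RuelleBand
import Summits.RiemannHypothesis.RiemannHypothesis.Theorems.ExactFirstBand.Negative.Reformulations
import Literature.Barriers.RiemannHypothesis.BohrDenseValuesProofs
import Literature.Barriers.RiemannHypothesis.BohrDenseValuesVoronin
import HarnessLib

/-!
# Sketch — crux-ideate r1/k1 for `ZetaWeakRecurrence` (stmt-RiemannHypothesis-18110)

Idea `banach-density-invariant-measure`: lift weak recurrence (WR) to its BANACH-DENSITY /
INVARIANT-MEASURE form.  Typed here:

* `HasPosBanachDensity`, `ZetaBanachRecurrence` (WR⁺: the return set has positive upper Banach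
  density beyond every height) and the trivial `ZetaBanachRecurrence → ZetaWeakRecurrence`;
* the abstract POINCARÉ STEP `frequently_mem_of_invariant_charging` (PROVED): a continuous map `f`,
  an `f`-invariant finite measure `ν` carried by the forward orbit closure of `x₀` and charging an
  open set `U` force `f^[n] x₀ ∈ U` for unboundedly many `n`;
* the transfer target (M) `InvariantMeasureChargesZeta` over `C(Strip, ℂ)` with the compact-open
  topology and the vertical unit shift, and the FIRST LEMMA
  `zetaWeakRecurrence_of_invariantMeasure : InvariantMeasureChargesZeta → ZetaWeakRecurrence`
  (statement; instantiation of the Poincaré step);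
* the rebalanced partner `OffLineZerosBanachNull` (ZB), `NoRightInteriorBand → ZB` (PROVED), and
  the alternative glue `exactFirstBand_of_banachRecurrence_of_banachNull : WR⁺ → ZB → ExactFirstBand`
  (statement).
-/

set_option linter.dupNamespace false

noncomputable section

open Complex Set Metric Filter Topology MeasureTheory
open scoped ENNReal NNReal

namespace Summit.RiemannHypothesis.RiemannHypothesis.Cruxes.ZetaWeakRecurrence.BanachDensity

open Summit.RiemannHypothesis.RiemannHypothesis.Theses.RuelleBand
open Literature.Barriers.RiemannHypothesis

/-! ## 1. Banach-density recurrence (WR⁺) -/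

/-- Positive upper Banach density, in the one-sided form used here: for some `δ > 0`, beyond
every height `T` and for arbitrarily long `L` there is a window `[x, x+L]`, `x ≥ T`, meeting `A`
in measure `≥ δ L`. -/
def HasPosBanachDensity (A : Set ℝ) : Prop :=
  ∃ δ : ℝ, 0 < δ ∧ ∀ T L₀ : ℝ, ∃ L x : ℝ, L₀ ≤ L ∧ T ≤ x ∧
    ENNReal.ofReal (δ * L) ≤ volume (A ∩ Icc x (x + L))

/-- WR⁺ (Banach-density shift-recurrence of `ζ`): on every closed disc of the half-strip the
`ε`-returns of `ζ` under vertical shifts form a set of positive upper Banach density. RH-implied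
(Bagchi: positive lower density); implies `ZetaWeakRecurrence`. -/
def ZetaBanachRecurrence : Prop :=
  ∀ (z : ℂ) (r : ℝ), 0 < r → r < min (z.re - 1 / 2) (1 - z.re) → ∀ ε : ℝ, 0 < ε →
    HasPosBanachDensity
      {τ : ℝ | ∀ s ∈ closedBall z r, ‖riemannZeta (s + τ * I) - riemannZeta s‖ < ε}

/-- A set meeting windows beyond every height in positive measure is unbounded above. -/
theorem HasPosBanachDensity.exists_ge {A : Set ℝ} (h : HasPosBanachDensity A) (T : ℝ) :
    ∃ τ ∈ A, T ≤ τ := by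
  obtain ⟨δ, hδ, h⟩ := h
  obtain ⟨L, x, hL, hx, hmeas⟩ := h T 1
  have hpos : 0 < volume (A ∩ Icc x (x + L)) := by
    refine lt_of_lt_of_le ?_ hmeas
    rw [ENNReal.ofReal_pos]
    exact mul_pos hδ (by linarith)
  obtain ⟨τ, hτA, hτx, -⟩ := nonempty_of_measure_ne_zero hpos.ne'
  exact ⟨τ, hτA, hx.trans hτx⟩

/-- WR⁺ ⟹ WR. -/
theorem zetaWeakRecurrence_of_banach (h : ZetaBanachRecurrence) : ZetaWeakRecurrence := by
  intro z r hr hrmin ε hε T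
  obtain ⟨τ, hτ, hTτ⟩ := (h z r hr hrmin ε hε).exists_ge T
  exact ⟨τ, hTτ, hτ⟩

/-! ## 2. The Poincaré step (abstract, proved) -/

/-- **Poincaré step.** `f` continuous, `ν` a finite `f`-invariant Borel measure carried by the
closure of the forward orbit of `x₀`; if `ν` charges an open set `U`, then the forward orbit of
`x₀` visits `U` at unboundedly many times. (Poincaré recurrence gives a `ν`-typical point of `U`
returning to `U`; it is a limit of orbit points, and continuity transports one return to `x₀`.)
-/
theorem frequently_mem_of_invariant_charging {X : Type*} [TopologicalSpace X] [MeasurableSpace X]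
    [OpensMeasurableSpace X] {f : X → X} (hf : Continuous f) {ν : Measure X} [IsFiniteMeasure ν]
    (hν : MeasurePreserving f ν ν) {x₀ : X}
    (horb : ∀ᵐ y ∂ν, y ∈ closure (Set.range fun n : ℕ => f^[n] x₀))
    {U : Set X} (hU : IsOpen U) (hpos : ν U ≠ 0) :
    ∃ᶠ n in atTop, f^[n] x₀ ∈ U := by
  have hc : Conservative f ν := hν.conservative
  have hrec := hc.ae_mem_imp_frequently_image_mem hU.measurableSet.nullMeasurableSet
  -- a point of `U` that is recurrent AND in the orbit closure
  have hgood : ∀ᵐ y ∂ν, (y ∈ U → ∃ᶠ n in atTop, f^[n] y ∈ U) ∧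
      y ∈ closure (Set.range fun n : ℕ => f^[n] x₀) := hrec.and horb
  have hUG : ν (U ∩ {y | (y ∈ U → ∃ᶠ n in atTop, f^[n] y ∈ U) ∧
      y ∈ closure (Set.range fun n : ℕ => f^[n] x₀)}) ≠ 0 := by
    rwa [measure_inter_conull]
    rw [ae_iff] at hgood
    simpa [Set.compl_def] using hgood
  obtain ⟨y, hyU, hyrec, hycl⟩ := nonempty_of_measure_ne_zero hUG
  have hfreq := hyrec hyU
  rw [Filter.frequently_atTop] at hfreq ⊢
  intro N
  obtain ⟨n, hnN, hn⟩ := hfreq N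
  -- transport the return through an orbit point close to `y`
  have hVopen : IsOpen ((f^[n]) ⁻¹' U) := hU.preimage (hf.iterate n)
  obtain ⟨w, hwV, ⟨m, rfl⟩⟩ := mem_closure_iff.1 hycl _ hVopen hn
  refine ⟨n + m, by omega, ?_⟩
  rw [Function.iterate_add_apply]
  exact hwV

/-! ## 3. The transfer target (M) over `C(Strip, ℂ)` and the FIRST LEMMA -/

/-- The open right half of the critical strip (vertically shift-invariant). -/
def Strip : Set ℂ := {s : ℂ | 1 / 2 < s.re ∧ s.re < 1}

theorem add_I_mem_Strip (s : Strip) : (s : ℂ) + I ∈ Strip := by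
  obtain ⟨h1, h2⟩ := s.2
  exact ⟨by simpa using h1, by simpa using h2⟩

/-- The vertical unit shift `s ↦ s + i` as a continuous self-map of the strip. -/
def shiftPt : C(Strip, Strip) where
  toFun s := ⟨(s : ℂ) + I, add_I_mem_Strip s⟩
  continuous_toFun := (continuous_subtype_val.add continuous_const).subtype_mk add_I_mem_Strip

/-- The shift flow (time `1`) on functions: `g ↦ g(· + i)`; continuous for the compact-open
topology. -/
def shiftOp : C(Strip, ℂ) → C(Strip, ℂ) := fun g => g.comp shiftPt

theorem continuous_shiftOp : Continuous shiftOp :=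
  ContinuousMap.continuous_precomp shiftPt

/-- `ζ` restricted to the strip, a point of `C(Strip, ℂ)`. -/
def zetaS : C(Strip, ℂ) where
  toFun s := riemannZeta s
  continuous_toFun := by
    refine continuous_iff_continuousAt.2 fun s => ?_
    have hs1 : (s : ℂ) ≠ 1 := by
      intro h; have := s.2.2; rw [h, one_re] at this; exact lt_irrefl _ this
    exact ((differentiableAt_riemannZeta hs1).continuousAt).comp continuous_subtype_val.continuousAt

/-- **(M) — the transfer target.** There is a Borel probability measure on `C(Strip, ℂ)`
(compact-open topology), invariant under the unit vertical shift, carried by the FORWARD orbit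
closure of `ζ`, and charging every sup-norm neighbourhood of `ζ` on every closed disc of the
strip. Under RH the Bagchi/Bohr–Jessen limit measure is such a `ν`; in a world with an off-line
zero it would have to be a NEW invariant measure, singular to the Bohr–Jessen one, charging
functions with zeros (a "zero-biased" Krylov–Bogolyubov limit). -/
def InvariantMeasureChargesZeta : Prop :=
  letI : MeasurableSpace C(Strip, ℂ) := borel _
  ∃ ν : Measure C(Strip, ℂ), IsProbabilityMeasure ν ∧ MeasurePreserving shiftOp ν ν ∧
    (∀ᵐ g ∂ν, g ∈ closure (Set.range fun n : ℕ => shiftOp^[n] zetaS)) ∧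
    ∀ (z : ℂ) (r : ℝ), 0 < r → r < min (z.re - 1 / 2) (1 - z.re) → ∀ ε : ℝ, 0 < ε →
      0 < ν {g : C(Strip, ℂ) | ∀ s : Strip, (s : ℂ) ∈ closedBall z r → ‖g s - riemannZeta s‖ < ε}

theorem closedBall_subset_Strip {z : ℂ} {r : ℝ} (hrmin : r < min (z.re - 1 / 2) (1 - z.re)) :
    closedBall z r ⊆ Strip := by
  intro s hs
  rw [mem_closedBall, dist_eq_norm] at hs
  have h := (abs_re_le_norm (s - z)).trans hs
  rw [sub_re, abs_le] at h
  have hr1 : r < z.re - 1 / 2 := hrmin.trans_le (min_le_left _ _)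
  have hr2 : r < 1 - z.re := hrmin.trans_le (min_le_right _ _)
  exact ⟨by linarith [h.1], by linarith [h.2]⟩

theorem shiftOp_iterate_apply (g : C(Strip, ℂ)) (n : ℕ) (s : Strip) :
    (shiftOp^[n] g) s = g (shiftPt^[n] s) := by
  induction n generalizing s with
  | zero => rfl
  | succ n ih =>
    rw [Function.iterate_succ_apply', Function.iterate_succ_apply]
    exact ih (shiftPt s)

theorem coe_shiftPt_iterate (n : ℕ) (s : Strip) :
    ((shiftPt^[n] s : Strip) : ℂ) = (s : ℂ) + n * I := by
  induction n generalizing s with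
  | zero => simp
  | succ n ih =>
    rw [Function.iterate_succ_apply']
    change ((shiftPt^[n] s : Strip) : ℂ) + I = _
    rw [ih]; push_cast; ring

/-- **FIRST LEMMA of the line (PROVED)**: the transfer `(M) ⟹ WR` — instantiation of the Poincaré
step on `C(Strip, ℂ)`: the sup-ball about `ζ` on a closed disc is open in the compact-open
topology (restriction to the compact disc is continuous into the sup-metric space `C(K, ℂ)`),
`shiftOp^[n] ζ = ζ(· + n i)`, and integer heights `n ≥ ⌈T⌉` suffice. -/
theorem zetaWeakRecurrence_of_invariantMeasure :
    InvariantMeasureChargesZeta → ZetaWeakRecurrence := by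
  intro hM z r hr hrmin ε hε T
  letI : MeasurableSpace C(Strip, ℂ) := borel _
  haveI : BorelSpace C(Strip, ℂ) := ⟨rfl⟩
  obtain ⟨ν, hprob, hν, horb, hch⟩ := hM
  haveI := hprob
  have hpos := hch z r hr hrmin ε hε
  -- the disc as a compact, nonempty subset of the strip
  have hKS : closedBall z r ⊆ Strip := closedBall_subset_Strip hrmin
  set K : Set Strip := Subtype.val ⁻¹' closedBall z r with hK
  have hKc : IsCompact K := by
    rw [Subtype.isCompact_iff]
    have himg : Subtype.val '' K = closedBall z r := by
      rw [hK, Subtype.image_preimage_coe, inter_eq_right.2 hKS]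
    rw [himg]
    exact isCompact_closedBall z r
  haveI : CompactSpace K := isCompact_iff_compactSpace.1 hKc
  haveI : Nonempty K :=
    ⟨⟨⟨z, hKS (mem_closedBall_self hr.le)⟩, by simp [hK, mem_closedBall_self hr.le]⟩⟩
  -- the sup-ball about `ζ` on the disc is open (compact-open topology)
  set U : Set C(Strip, ℂ) :=
    {g | ∀ s : Strip, (s : ℂ) ∈ closedBall z r → ‖g s - riemannZeta s‖ < ε} with hU
  have hUeq : U = (fun g : C(Strip, ℂ) => g.restrict K) ⁻¹' Metric.ball (zetaS.restrict K) ε := by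
    ext g
    simp only [hU, Set.mem_setOf_eq, Set.mem_preimage, Metric.mem_ball]
    rw [ContinuousMap.dist_lt_iff_of_nonempty]
    constructor
    · intro h k
      rw [dist_eq_norm]
      exact h k.1 k.2
    · intro h s hs
      have := h ⟨s, hs⟩
      rwa [dist_eq_norm] at this
  have hUopen : IsOpen U := by
    rw [hUeq]
    exact Metric.isOpen_ball.preimage (ContinuousMap.continuous_restrict K)
  -- Poincaré step, then read off a late integer return
  have hfreq := frequently_mem_of_invariant_charging continuous_shiftOp hν horb hUopen hpos.ne'
  obtain ⟨n, hn, hnU⟩ := Filter.frequently_atTop.1 hfreq ⌈T⌉₊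
  refine ⟨n, (Nat.le_ceil T).trans (by exact_mod_cast hn), fun s hs => ?_⟩
  have hsS : s ∈ Strip := hKS hs
  have key : (shiftOp^[n] zetaS) ⟨s, hsS⟩ = riemannZeta (s + (n : ℝ) * I) := by
    rw [shiftOp_iterate_apply]
    change riemannZeta ((shiftPt^[n] ⟨s, hsS⟩ : Strip) : ℂ) = _
    rw [coe_shiftPt_iterate]
    push_cast; rfl
  have := hnU ⟨s, hsS⟩ hs
  rwa [key] at this

/-! ## 4. The rebalanced partner (ZB) and the alternative glue -/

/-- ZB — OFF-LINE ZEROS HAVE UPPER BANACH DENSITY ZERO near every interior abscissa: for each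
`σ₀ ∈ (1/2,1)` there is a window `|Re s − σ₀| < η` in which, for every `c > 0`, all height
intervals `[x, x+L]` with `L ≥ L₀(c)` contain at most `cL` zeros. `NoRightInteriorBand ⟹ ZB`
(finitely many zeros in the window); ZB allows infinitely many off-line zeros near `σ₀`. -/
def OffLineZerosBanachNull : Prop :=
  ∀ σ₀ : ℝ, 1 / 2 < σ₀ → σ₀ < 1 → ∃ η : ℝ, 0 < η ∧ ∀ c : ℝ, 0 < c → ∃ L₀ : ℝ, ∀ L x : ℝ, L₀ ≤ L →
    ∃ F : Finset ℂ, {s : ℂ | riemannZeta s = 0 ∧ |s.re - σ₀| < η ∧ x ≤ s.im ∧ s.im ≤ x + L} ⊆ ↑F ∧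
      (F.card : ℝ) ≤ c * L

/-- `NoRightInteriorBand ⟹ ZB` (a finite zero set in the window has Banach density zero). -/
theorem offLineZerosBanachNull_of_noRightInteriorBand (h : NoRightInteriorBand) :
    OffLineZerosBanachNull := by
  intro σ₀ h1 h2
  obtain ⟨ε, hε, hfin⟩ := h σ₀ h1 h2
  -- shrink the window so that it lies inside the open strip
  set η : ℝ := min ε (min (σ₀ - 1 / 2) (1 - σ₀)) with hηdef
  have hη : 0 < η := lt_min hε (lt_min (by linarith) (by linarith))
  have hηε : η ≤ ε := min_le_left _ _
  have hη1 : η ≤ σ₀ - 1 / 2 := (min_le_right _ _).trans (min_le_left _ _)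
  have hη2 : η ≤ 1 - σ₀ := (min_le_right _ _).trans (min_le_right _ _)
  refine ⟨η, hη, fun c hc => ⟨(hfin.toFinset.card : ℝ) / c, fun L x hL => ⟨hfin.toFinset, ?_, ?_⟩⟩⟩
  · intro s hs
    obtain ⟨hs0, hsre, -, -⟩ := hs
    rw [abs_lt] at hsre
    simp only [Finset.mem_coe, Set.Finite.mem_toFinset, Set.mem_setOf_eq]
    refine ⟨hs0, by linarith, by linarith, ?_⟩
    rw [abs_lt]; constructor <;> linarith
  · rw [div_le_iff₀ hc] at hL
    linarith [mul_comm c L]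

/-- Reflection of zeros across the critical line (functional equation). [folklore] -/
theorem zeta_one_sub_eq_zero {ρ : ℂ} (hζ : riemannZeta ρ = 0) (hρ : 0 < ρ.re) :
    riemannZeta (1 - ρ) = 0 := by
  have h1 : ρ ≠ 1 := by
    rintro rfl
    exact riemannZeta_one_ne_zero hζ
  have h2 : ∀ n : ℕ, ρ ≠ -n := by
    intro n h
    have := congrArg Complex.re h
    simp at this
    linarith [(n.cast_nonneg : (0 : ℝ) ≤ n)]
  rw [riemannZeta_one_sub h2 h1, hζ, mul_zero]

/-- **ALTERNATIVE GLUE (PROVED)** — Bagchi's counting run in SLIDING WINDOWS: WR⁺ and ZB give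
`ExactFirstBand`. An off-line zero `ξ` (w.l.o.g. `Re ξ > 1/2`) is isolated; with
`ε = min |ζ|` on a small circle about `ξ`, every return `τ` generates (Rouché,
`exists_zero_near_shift`) a zero within `δ` of `ξ + iτ`; the returns in a window `[x, x+L]` are
therefore covered by `2δ`-intervals about the heights of the zeros of the box
`|Re s − Re ξ| < η`, `Im s ∈ [x + Im ξ − δ, x + Im ξ + L + δ]`; WR⁺ supplies windows with return
measure `≥ δ_B L`, ZB (at `c = δ_B/(4δ)`) bounds the zeros by `c (L + 2δ)`: contradiction for
`L > 2δ`. -/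
theorem exactFirstBand_of_banachRecurrence_of_banachNull :
    ZetaBanachRecurrence → OffLineZerosBanachNull → ExactFirstBand := by
  intro hW hZ s hs h0 h1
  by_contra hnot
  push Not at hnot
  obtain ⟨hne, -⟩ := hnot
  -- Step 0: an off-line zero `ξ` in the right half of the open strip
  obtain ⟨ξ, hξ0, hξhalf, hξ1⟩ : ∃ ξ : ℂ, riemannZeta ξ = 0 ∧ 1 / 2 < ξ.re ∧ ξ.re < 1 := by
    rcases lt_or_gt_of_ne hne with hlt | hgt
    · refine ⟨1 - s, zeta_one_sub_eq_zero hs h0, ?_, ?_⟩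
      · simp only [sub_re, one_re]; linarith
      · simp only [sub_re, one_re]; linarith
    · exact ⟨s, hs, hgt, h1⟩
  -- Step 1: ZB at `σ₀ = Re ξ`: a window of half-width `η` and the threshold function `L₀`
  obtain ⟨η, hη, hZB⟩ := hZ ξ.re hξhalf hξ1
  -- Step 2: `ξ` is an isolated zero
  have hξne1 : ξ ≠ 1 := by
    intro h; rw [h, one_re] at hξ1; exact lt_irrefl _ hξ1
  have han : AnalyticAt ℂ riemannZeta ξ := analyticOn_riemannZeta ξ hξne1
  have hev : ∀ᶠ w in 𝓝[≠] ξ, riemannZeta w ≠ 0 := by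
    rcases han.eventually_eq_zero_or_eventually_ne_zero with h0' | hne'
    · exfalso
      have h2 : riemannZeta 2 = 0 :=
        analyticOn_riemannZeta.eqOn_zero_of_preconnected_of_eventuallyEq_zero
          (isConnected_compl_singleton_of_one_lt_rank (by simp) (1 : ℂ)).isPreconnected hξne1 h0'
          (show (2 : ℂ) ∈ ({1}ᶜ : Set ℂ) by norm_num)
      exact riemannZeta_ne_zero_of_one_le_re (s := 2) (by norm_num) h2
    · exact hne'
  obtain ⟨δ₁, hδ₁, hpunct⟩ : ∃ δ₁ > 0, ∀ w : ℂ, dist w ξ < δ₁ → w ≠ ξ → riemannZeta w ≠ 0 := by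
    rw [eventually_nhdsWithin_iff, Metric.eventually_nhds_iff] at hev
    obtain ⟨δ₁, hδ₁, h⟩ := hev
    exact ⟨δ₁, hδ₁, fun w hw hne ↦ h hw hne⟩
  -- Step 3: a radius `δ` inside the punctured disc, inside the strip, and inside the ZB window
  set m : ℝ := min (ξ.re - 1 / 2) (1 - ξ.re) with hmdef
  have hmpos : 0 < m := lt_min (by linarith) (by linarith)
  set δ : ℝ := min (min (δ₁ / 2) (m / 2)) (η / 2) with hδdef
  have hδpos : 0 < δ := lt_min (lt_min (by linarith) (by linarith)) (by linarith)
  have hδ₁' : δ < δ₁ := ((min_le_left _ _).trans (min_le_left _ _)).trans_lt (by linarith)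
  have hδm : δ < m := ((min_le_left _ _).trans (min_le_right _ _)).trans_lt (by linarith)
  have hδη : δ < η := (min_le_right _ _).trans_lt (by linarith)
  have hδone : δ < 1 - ξ.re := hδm.trans_le (min_le_right _ _)
  -- Step 4: `ε := min_{|w−ξ|=δ} |ζ(w)| > 0`
  have hcont : ContinuousOn (fun w ↦ ‖riemannZeta w‖) (sphere ξ δ) := by
    refine ContinuousOn.norm fun w hw ↦ ?_
    have hw1 : w ≠ 1 := by
      intro h
      rw [h, mem_sphere, dist_eq_norm] at hw
      have := abs_re_le_norm (1 - ξ)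
      rw [hw, sub_re, one_re] at this
      rw [abs_le] at this
      linarith [this.1]
    exact (differentiableAt_riemannZeta hw1).continuousAt.continuousWithinAt
  obtain ⟨w₀, hw₀, hmin⟩ := (isCompact_sphere ξ δ).exists_isMinOn
    (NormedSpace.sphere_nonempty.2 hδpos.le) hcont
  set ε : ℝ := ‖riemannZeta w₀‖ with hεdef
  have hεpos : 0 < ε := by
    rw [hεdef, norm_pos_iff]
    refine hpunct w₀ ?_ ?_
    · rw [mem_sphere.1 hw₀]; exact hδ₁'
    · intro h
      have := mem_sphere.1 hw₀
      rw [h, dist_self] at this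
      exact hδpos.ne this
  have hεle : ∀ w ∈ sphere ξ δ, ε ≤ ‖riemannZeta w‖ := fun w hw ↦ hmin hw
  -- Step 5: WR⁺ on the disc `closedBall ξ δ` at level `ε`: Banach constant `δB`
  obtain ⟨δB, hδB, hwin⟩ := hW ξ δ hδpos hδm ε hεpos
  -- Step 6: ZB at `c := δB / (4δ)`, then a long return-rich window
  obtain ⟨L₀, hL₀⟩ := hZB (δB / (4 * δ)) (by positivity)
  obtain ⟨L, x, hL, -, hmeas⟩ := hwin 0 (max L₀ (4 * δ + 1))
  have hLL₀ : L₀ ≤ L := (le_max_left _ _).trans hL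
  have hL4 : 4 * δ + 1 ≤ L := (le_max_right _ _).trans hL
  -- the zeros of the box covering the generated zeros
  obtain ⟨F, hFsub, hFcard⟩ := hL₀ (L + 2 * δ) (x + ξ.im - δ) (by linarith)
  set R : Set ℝ := {τ : ℝ | ∀ s ∈ closedBall ξ δ, ‖riemannZeta (s + τ * I) - riemannZeta s‖ < ε}
    with hR
  -- Step 7: covering of the returns in the window by `2δ`-intervals about the zero heights
  have hcover : R ∩ Icc x (x + L) ⊆ ⋃ ρ ∈ F, ball (ρ.im - ξ.im) δ := by
    rintro τ ⟨hτR, hτx, hτxL⟩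
    obtain ⟨ρ, hρ0, hρd⟩ := exists_zero_near_shift hξ0 hδpos (by linarith) hεle hτR
    rw [dist_eq_norm] at hρd
    have hρre : |ρ.re - ξ.re| < δ := by
      have := (abs_re_le_norm (ρ - (ξ + τ * I))).trans_lt hρd
      simpa using this
    have hρim : |ρ.im - ξ.im - τ| < δ := by
      have := (abs_im_le_norm (ρ - (ξ + τ * I))).trans_lt hρd
      simpa [sub_sub] using this
    have hρim' := hρim
    rw [abs_lt] at hρim'
    refine mem_iUnion₂.2 ⟨ρ, ?_, ?_⟩
    · apply hFsub
      refine ⟨hρ0, hρre.trans hδη, by linarith, by linarith⟩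
    · rw [mem_ball, Real.dist_eq, abs_sub_comm]
      simpa [sub_sub] using hρim
  -- Step 8: measure comparison
  have hvol : volume (R ∩ Icc x (x + L)) ≤ ENNReal.ofReal (δB / 2 * (L + 2 * δ)) := by
    calc volume (R ∩ Icc x (x + L))
        ≤ volume (⋃ ρ ∈ F, ball (ρ.im - ξ.im) δ) := measure_mono hcover
      _ ≤ ∑ ρ ∈ F, volume (ball (ρ.im - ξ.im) δ) := measure_biUnion_finset_le F _
      _ = (F.card : ℝ≥0∞) * ENNReal.ofReal (2 * δ) := by simp [Real.volume_ball]
      _ = ENNReal.ofReal ((F.card : ℝ) * (2 * δ)) := by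
          rw [ENNReal.ofReal_mul (p := (F.card : ℝ)) (Nat.cast_nonneg _), ENNReal.ofReal_natCast]
      _ ≤ ENNReal.ofReal (δB / 2 * (L + 2 * δ)) := by
          apply ENNReal.ofReal_le_ofReal
          have h2δ : (0 : ℝ) ≤ 2 * δ := by positivity
          calc (F.card : ℝ) * (2 * δ) ≤ δB / (4 * δ) * (L + 2 * δ) * (2 * δ) :=
                mul_le_mul_of_nonneg_right hFcard h2δ
            _ = δB / 2 * (L + 2 * δ) := by field_simp; ring
  have hfinal := hmeas.trans hvol
  have hLpos : 0 < L := by linarith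
  have hnn : 0 ≤ δB / 2 * (L + 2 * δ) := by positivity
  rw [ENNReal.ofReal_le_ofReal_iff hnn] at hfinal
  nlinarith

/-! ## 5. Calibration: the rebalanced cut is LOSSLESS (`RH ↔ ZB ∧ WR⁺`) -/

/-- Positive lower (asymptotic) density ⟹ positive upper Banach density (windows `[x, x+L]` with
`L ≥ 2x(1−δ)/δ` carry measure `≥ (δ/2) L`). [folklore] -/
theorem hasPosBanachDensity_of_hasPosLowerDensity {A : Set ℝ} (h : HasPosLowerDensity A) :
    HasPosBanachDensity A := by
  obtain ⟨δ, hδ, T₀, hT₀⟩ := h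
  refine ⟨δ / 2, by positivity, fun T L₀ => ?_⟩
  set x : ℝ := max T 0 with hx
  have hx0 : 0 ≤ x := le_max_right _ _
  set L : ℝ := max (max L₀ (T₀ - x)) (2 * x / δ) with hL
  refine ⟨L, x, (le_max_left _ _).trans (le_max_left _ _), le_max_left _ _, ?_⟩
  have hxL : T₀ ≤ x + L := by
    have : T₀ - x ≤ L := (le_max_right _ _).trans (le_max_left _ _)
    linarith
  have hL2 : 2 * x / δ ≤ L := le_max_right _ _
  have hmeas := hT₀ (x + L) hxL
  -- `A ∩ [0, x+L] ⊆ [0, x] ∪ (A ∩ [x, x+L])`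
  have hsub : A ∩ Icc 0 (x + L) ⊆ Icc 0 x ∪ (A ∩ Icc x (x + L)) := by
    rintro τ ⟨hτA, hτ0, hτL⟩
    by_cases hτx : τ ≤ x
    · exact Or.inl ⟨hτ0, hτx⟩
    · exact Or.inr ⟨hτA, (not_le.1 hτx).le, hτL⟩
  have h1 : ENNReal.ofReal (δ * (x + L)) ≤ ENNReal.ofReal x + volume (A ∩ Icc x (x + L)) := by
    calc ENNReal.ofReal (δ * (x + L)) ≤ volume (A ∩ Icc 0 (x + L)) := hmeas
      _ ≤ volume (Icc 0 x ∪ (A ∩ Icc x (x + L))) := measure_mono hsub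
      _ ≤ volume (Icc 0 x) + volume (A ∩ Icc x (x + L)) := measure_union_le _ _
      _ = ENNReal.ofReal x + volume (A ∩ Icc x (x + L)) := by rw [Real.volume_Icc, sub_zero]
  -- `δ (x+L) − x ≥ (δ/2) L` since `L ≥ 2x/δ`
  have hxδ : x ≤ δ / 2 * L := by
    rw [div_le_iff₀ hδ] at hL2
    nlinarith
  have hkey : ENNReal.ofReal (δ / 2 * L) + ENNReal.ofReal x ≤ ENNReal.ofReal (δ * (x + L)) := by
    rw [← ENNReal.ofReal_add (by positivity) hx0]
    apply ENNReal.ofReal_le_ofReal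
    nlinarith
  have h2 := hkey.trans h1
  rw [add_comm] at h2
  exact (ENNReal.add_le_add_iff_left ENNReal.ofReal_ne_top).1 h2

/-- RH ⟹ WR⁺ (Bagchi's strong recurrence from the tree's PROVED Voronin theorem, then
lower ⟹ Banach density). [cite: Steuding2007, Thm. 8.3] -/
theorem zetaBanachRecurrence_of_riemannHypothesis (h : RiemannHypothesis) : ZetaBanachRecurrence := by
  intro z r hr hrmin ε hε
  have hz1 : 1 / 2 < z.re := by
    have := hrmin.trans_le (min_le_left _ _); linarith
  have hz2 : z.re < 1 := by
    have := hrmin.trans_le (min_le_right _ _); linarith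
  exact hasPosBanachDensity_of_hasPosLowerDensity
    ((riemannHypothesis_iff_strongRecurrence_of_Voronin Voronin1975_universality_holds).1 h ε hε z
      hz1 hz2 r hr hrmin)

/-- RH ⟹ ZB (no zeros in the window at all). -/
theorem offLineZerosBanachNull_of_riemannHypothesis (h : RiemannHypothesis) :
    OffLineZerosBanachNull := by
  intro σ₀ h1 h2
  set η : ℝ := min (σ₀ - 1 / 2) (1 - σ₀) with hηdef
  have hη : 0 < η := lt_min (by linarith) (by linarith)
  have hη1 : η ≤ σ₀ - 1 / 2 := min_le_left _ _
  have hη2 : η ≤ 1 - σ₀ := min_le_right _ _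
  refine ⟨η, hη, fun c hc => ⟨0, fun L x hL => ⟨∅, ?_, by simp; nlinarith⟩⟩⟩
  intro s hs
  obtain ⟨hs0, hsre, -, -⟩ := hs
  exfalso
  rw [abs_lt] at hsre
  have hspos : 0 < s.re := by linarith
  have hslt : s.re < 1 := by linarith
  have hnt : ¬∃ n : ℕ, s = -2 * (n + 1) := by
    rintro ⟨n, hn⟩
    have := congrArg Complex.re hn
    simp at this
    linarith [(n.cast_nonneg : (0 : ℝ) ≤ n)]
  have hs1 : s ≠ 1 := by
    intro h1'; rw [h1', one_re] at hslt; exact lt_irrefl _ hslt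
  have := h s hs0 hnt hs1
  linarith

/-- **The rebalanced cut is LOSSLESS**: `RH ↔ ZB ∧ WR⁺` (so refuting either piece refutes RH,
and neither piece alone is known to be RH-equivalent). -/
theorem riemannHypothesis_iff_banachNull_and_banachRecurrence :
    RiemannHypothesis ↔ OffLineZerosBanachNull ∧ ZetaBanachRecurrence := by
  refine ⟨fun h => ⟨offLineZerosBanachNull_of_riemannHypothesis h,
    zetaBanachRecurrence_of_riemannHypothesis h⟩, fun h => ?_⟩
  exact Summit.RiemannHypothesis.Cruxes.ExactFirstBand.Negative.exactFirstBand_iff_riemannHypothesis.1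
    (exactFirstBand_of_banachRecurrence_of_banachNull h.2 h.1)

/-- And at the level of the route's deciding node: `X ↔ ZB ∧ WR⁺`. -/
theorem exactFirstBand_iff_banachNull_and_banachRecurrence :
    ExactFirstBand ↔ OffLineZerosBanachNull ∧ ZetaBanachRecurrence :=
  Summit.RiemannHypothesis.Cruxes.ExactFirstBand.Negative.exactFirstBand_iff_riemannHypothesis.trans
    riemannHypothesis_iff_banachNull_and_banachRecurrence

end Summit.RiemannHypothesis.RiemannHypothesis.Cruxes.ZetaWeakRecurrence.BanachDensity

end
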